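import Literature.Analysis.ValidatedNumerics.TaylorModelL2
import Literature.Analysis.ValidatedNumerics.ExpPoly.Correlation
import HarnessLib

/-!
# Integrals with a MOVING endpoint against a panelled weight, as Taylor models

Trunk T-ANA (Analysis/ValidatedNumerics); namespace `Literature.Analysis.ValidatedNumerics.PolyMP`.
Sequel of `TaylorModelQuadrature.lean` / `TaylorModelL2.lean`.  A transcendental weight `w` on `[0, ∞)` is given PANEL BY
PANEL by Taylor models: panel `j` is `[2jh, (2j+2)h]` with centre `t_j = (2j+1)h`, and `W_j` encloses `u ↦ w(t_j + u)` on
`|u| ≤ h` (reference polynomial `pw_j`).  For an exact rational polynomial `q(t)` — and then for a BIVARIATE family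
`Q(ρ, t) = Σ_a Q_a(t) ρ^a` — this file builds KERNEL-COMPUTABLE enclosures of

* the full-panel integrals `∫_{2j₀h}^{2(j₀+n)h} w(t) q(t) dt` as an interval `fullPanelsI` (`mem_fullPanelsI`; each panel by
  `abs_integral_mul_sub_integPolyQ_le` with the exactly re-centred `q(t_j + u) = BPoly.subst (BPoly.taylor q) [t_j]`);
* the partial-panel integral `λ ↦ ∫_{-h}^{λ} w(t_j+u) q(t_j+u) du` as a Taylor model in `λ` (`partPanelTM`, `tmem_partPanelTM`:
  exact polynomial part + remainder folded into the constant coefficient — `tmem_partialMoment` with a polynomial weight);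
* the MOVING-ENDPOINT integral `ρ ↦ ∫_0^{t_j ± ρ} w(t) q(t) dt` (`movingIntegTM`, `tmem_movingIntegTM`) and its bivariate version
  `ρ ↦ ∫_0^{t_j ± ρ} w(t) Q(ρ, t) dt` (`movingIntegBTM`, `tmem_movingIntegBTM`),
together with the two small Taylor-model operations they need: reflection `ρ ↦ f(−ρ)` (`treflI`, `tmem_refl`) and
multiplication by `ρ` (`tmulXI`, `tmem_mulX`).  Written for the window images of the Weil form (the archimedean layer
`∫_0^{c∓y} G(t) E(y,t) dt` of a windowed polynomial has an endpoint moving with `y` and a polynomial integrand in `(y, t)`),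
but problem-independent.  No facts, no axioms.

## References

* K. Makino, M. Berz, *Taylor models and other validated functional inclusion methods*, Int. J. Pure Appl. Math. 4
  (2003) 379–456, §6 (antiderivation). [folklore]
-/

open MeasureTheory intervalIntegral Set
open scoped Interval

namespace Literature.Analysis.ValidatedNumerics

namespace PolyMP

open Literature.Analysis.ValidatedNumerics.NumericsMP
open Literature.Analysis.ValidatedNumerics.ExpPoly (Poly BPoly)
open Literature.Analysis.ValidatedNumerics.ExpPoly

/-! ### Two Taylor-model operations: reflection and multiplication by the variable -/

/-- Coefficient list of `ρ ↦ p(−ρ)`: alternate the signs. [folklore] -/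
noncomputable def reflR : List ℝ → List ℝ
  | [] => []
  | a :: as => a :: (reflR as).map Neg.neg

/-- [folklore] -/
theorem evalR_reflR : ∀ (as : List ℝ) (x : ℝ), evalR (reflR as) x = evalR as (-x)
  | [], x => by simp [reflR]
  | a :: as, x => by
      rw [reflR, evalR_cons, evalR_map_neg, evalR_reflR as x, evalR_cons]
      ring

/-- Taylor model of `ρ ↦ f(−ρ)`. [folklore] -/
def treflI : IPoly → IPoly
  | [] => []
  | I :: P => I :: (treflI P).map MI.neg

/-- [folklore] -/
theorem pmem_treflI {S : ℕ} : ∀ {as : List ℝ} {P : IPoly}, PMem S as P → PMem S (reflR as) (treflI P)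
  | [], [], _ => by simpa [reflR, treflI] using pmem_nil S
  | _ :: _, _ :: _, List.Forall₂.cons ha hP => by
      rw [reflR, treflI]
      exact pmem_cons ha (pmem_neg (pmem_treflI hP))

/-- **Reflection**: `TMem S h f P → TMem S h (ρ ↦ f(−ρ)) (treflI P)`. [folklore] -/
theorem tmem_refl {S : ℕ} {h : ℚ} {f : ℝ → ℝ} {P : IPoly} (hf : TMem S h f P) :
    TMem S h (fun ρ => f (-ρ)) (treflI P) := fun ρ hρ => by
  obtain ⟨as, has, ef⟩ := hf (-ρ) (by rwa [abs_neg])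
  exact ⟨reflR as, pmem_treflI has, by beta_reduce; rw [evalR_reflR, ef]⟩

/-- Taylor model of `ρ ↦ ρ · f(ρ)`: shift the coefficients. [folklore] -/
def tmulXI (P : IPoly) : IPoly := MI.ofScaled 0 :: P

/-- **Multiplication by the variable**: `TMem S h f P → TMem S h (ρ ↦ ρ f(ρ)) (tmulXI P)`. [folklore] -/
theorem tmem_mulX {S : ℕ} (hS : 0 < S) {h : ℚ} {f : ℝ → ℝ} {P : IPoly} (hf : TMem S h f P) :
    TMem S h (fun ρ => ρ * f ρ) (tmulXI P) := fun ρ hρ => by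
  obtain ⟨as, has, ef⟩ := hf ρ hρ
  refine ⟨0 :: as, pmem_cons (by simpa using MI.mem_ofScaled hS 0) has, ?_⟩
  beta_reduce
  rw [evalR_cons, ef, zero_add]

/-! ### Panels -/

/-- The centre `t_j = (2j+1)h` of panel `j`. [folklore] -/
def panelCentre (h : ℚ) (j : ℕ) : ℚ := (2 * j + 1) * h

/-- `q(t_j + u)` as an exact polynomial in `u`. [folklore] -/
def recenter (q : Poly) (h : ℚ) (j : ℕ) : Poly := BPoly.subst (BPoly.taylor q) [panelCentre h j]

/-- [folklore] -/
theorem eval_recenter (q : Poly) (h : ℚ) (j : ℕ) (u : ℝ) :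
    Poly.eval (recenter q h j) u = Poly.eval q ((panelCentre h j : ℝ) + u) := by
  rw [recenter, BPoly.eval_subst, BPoly.eval_taylor]
  simp [Poly.eval, add_comm]

/-! ### One full panel: an interval -/

/-- Enclosure of `∫_{-h}^{h} f(u) q(u) du` from a Taylor model `W` of `f` with reference polynomial `pw`:
centre `integPolyQ pw q h`, scaled radius `⌈tabsI S h (W − pw) · 2h · ‖q‖_h⌉`. [folklore] -/
def panelIntegI (S : ℕ) (h : ℚ) (W : IPoly) (pw q : Poly) : MI :=
  MI.widen (ofRat S (integPolyQ pw q h)) ⌈(tabsI S h (tsubI W (ratPolyI S pw)) : ℚ) * (2 * h * absBoundQ q h)⌉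

/-- [folklore] -/
theorem mem_panelIntegI {S : ℕ} (hS : 0 < S) {h : ℚ} (h0 : 0 ≤ h) {f : ℝ → ℝ} {W : IPoly}
    (hf : TMem S h f W) (hfi : IntervalIntegrable f volume (-(h : ℝ)) h) (pw q : Poly) :
    MI.mem S (∫ u in (-(h : ℝ))..h, f u * Poly.eval q u) (panelIntegI S h W pw q) := by
  have hb := abs_integral_mul_sub_integPolyQ_le hS h0 hf hfi pw q
  refine MI.mem_widen (mem_ofRat S (integPolyQ pw q h)) ?_
  have hSr : (0 : ℝ) < S := by exact_mod_cast hS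
  have hb' : |(∫ u in (-(h : ℝ))..h, f u * Poly.eval q u) - ((integPolyQ pw q h : ℚ) : ℝ)| ≤
      (tabsI S h (tsubI W (ratPolyI S pw)) : ℝ) * (2 * h * absBoundQ q h) / S := by
    rwa [div_mul_eq_mul_div] at hb
  have h1 := (le_div_iff₀ hSr).1 hb'
  refine h1.trans ?_
  have h2 := Int.le_ceil ((tabsI S h (tsubI W (ratPolyI S pw)) : ℚ) * (2 * h * absBoundQ q h))
  exact_mod_cast h2

/-! ### A run of full panels: an interval -/

/-- Enclosure of `∫_{2j₀h}^{2(j₀+n)h} w(t) q(t) dt` from the panel data `(W_j, pw_j)`, `j = j₀, …, j₀+n−1`. [folklore] -/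
def fullPanelsI (S : ℕ) (h : ℚ) (q : Poly) : List (IPoly × Poly) → ℕ → MI
  | [], _ => MI.ofScaled 0
  | (W, pw) :: D, j => MI.add (panelIntegI S h W pw (recenter q h j)) (fullPanelsI S h q D (j + 1))

/-- **Full panels.**  If `W_i` encloses `u ↦ w(t_{j₀+i} + u)` for every entry of the data and `w` is interval integrable on
the subintervals of `[0, ∞)`, then `fullPanelsI` encloses `∫_{2j₀h}^{2(j₀+n)h} w(t) q(t) dt`. [folklore] -/
theorem mem_fullPanelsI {S : ℕ} (hS : 0 < S) {h : ℚ} (h0 : 0 ≤ h) {w : ℝ → ℝ}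
    (hwi : ∀ a b : ℝ, 0 ≤ a → a ≤ b → IntervalIntegrable w volume a b) (q : Poly) :
    ∀ (D : List (IPoly × Poly)) (j₀ : ℕ),
      (∀ i : Fin D.length, TMem S h (fun u => w ((panelCentre h (j₀ + i) : ℝ) + u)) (D.get i).1) →
      MI.mem S (∫ t in (2 * j₀ * h : ℝ)..(2 * (j₀ + D.length) * h : ℝ), w t * Poly.eval q t)
        (fullPanelsI S h q D j₀)
  | [], j₀, _ => by
      simp only [List.length_nil, Nat.cast_zero, add_zero, intervalIntegral.integral_same, fullPanelsI]
      simpa using MI.mem_ofScaled hS 0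
  | (W, pw) :: D, j₀, hD => by
      have hhr : (0 : ℝ) ≤ h := by exact_mod_cast h0
      have hj₀ : (0 : ℝ) ≤ j₀ := by exact_mod_cast Nat.zero_le j₀
      rw [fullPanelsI]
      -- split off the first panel
      have hI1 : IntervalIntegrable (fun t => w t * Poly.eval q t) volume (2 * j₀ * h : ℝ) (2 * (j₀ + 1) * h : ℝ) :=
        (hwi _ _ (by positivity) (by nlinarith)).mul_continuousOn (Poly.continuous_eval q).continuousOn
      have hI2 : IntervalIntegrable (fun t => w t * Poly.eval q t) volume (2 * (j₀ + 1) * h : ℝ)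
          (2 * (j₀ + ((W, pw) :: D).length) * h : ℝ) :=
        (hwi _ _ (by positivity) (by simp; nlinarith)).mul_continuousOn (Poly.continuous_eval q).continuousOn
      rw [← integral_add_adjacent_intervals hI1 hI2]
      refine MI.mem_add ?_ ?_
      · -- the first panel, shifted to `[-h, h]`
        have hW : TMem S h (fun u => w ((panelCentre h j₀ : ℝ) + u)) W := by simpa using hD ⟨0, by simp⟩
        have hfi : IntervalIntegrable (fun u => w ((panelCentre h j₀ : ℝ) + u)) volume (-(h : ℝ)) h := by
          have := (hwi (2 * j₀ * h) (2 * (j₀ + 1) * h) (by positivity) (by nlinarith)).comp_add_right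
            ((panelCentre h j₀ : ℝ))
          simp only [panelCentre, Rat.cast_mul, Rat.cast_add, Rat.cast_ofNat, Rat.cast_natCast, Rat.cast_one] at this ⊢
          convert this using 1 <;> ring
        have hm := mem_panelIntegI hS h0 hW hfi pw (recenter q h j₀)
        have e : ∫ u in (-(h : ℝ))..h, w ((panelCentre h j₀ : ℝ) + u) * Poly.eval (recenter q h j₀) u =
            ∫ t in (2 * j₀ * h : ℝ)..(2 * (j₀ + 1) * h : ℝ), w t * Poly.eval q t := by
          simp_rw [eval_recenter]
          have hs := intervalIntegral.integral_comp_add_left (fun t => w t * Poly.eval q t) ((panelCentre h j₀ : ℝ))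
            (a := -(h : ℝ)) (b := h)
          rw [hs]
          simp only [panelCentre]
          push_cast
          congr 1 <;> ring
        rwa [e] at hm
      · have hD' : ∀ i : Fin D.length, TMem S h (fun u => w ((panelCentre h (j₀ + 1 + i) : ℝ) + u)) (D.get i).1 := by
          intro i
          have := hD ⟨i + 1, by simp⟩
          simpa [Nat.add_assoc, Nat.add_comm 1 i] using this
        have ih := mem_fullPanelsI hS h0 hwi q D (j₀ + 1) hD'
        simp only [List.length_cons, Nat.cast_succ] at ih ⊢
        convert ih using 3; ring

/-! ### The partial panel: a Taylor model in the endpoint -/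

/-- The exact polynomial `λ ↦ ∫_{-h}^{λ} pw(u) q(u) du`. [folklore] -/
def partIntegPoly (pw q : Poly) (h : ℚ) : Poly :=
  Poly.add (Poly.ad 0 (Poly.mul pw q)) [-(Poly.evalQ (Poly.ad 0 (Poly.mul pw q)) (-h))]

/-- [folklore] -/
theorem eval_partIntegPoly (pw q : Poly) (h : ℚ) (x : ℝ) :
    Poly.eval (partIntegPoly pw q h) x =
      Poly.eval (Poly.ad 0 (Poly.mul pw q)) x - Poly.eval (Poly.ad 0 (Poly.mul pw q)) (-(h : ℝ)) := by
  rw [partIntegPoly, Poly.eval_add]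
  have e : Poly.eval [-(Poly.evalQ (Poly.ad 0 (Poly.mul pw q)) (-h))] x =
      -Poly.eval (Poly.ad 0 (Poly.mul pw q)) (-(h : ℝ)) := by
    simp only [Poly.eval, mul_zero, add_zero, Rat.cast_neg]
    rw [Poly.eval_evalQ, Rat.cast_neg]
  rw [e]
  ring

/-- `∫_{-h}^{λ} pw(u) q(u) du = partIntegPoly pw q h (λ)`. [folklore] -/
theorem integral_poly_mul_poly_eq (pw q : Poly) (h : ℚ) (x : ℝ) :
    ∫ u in (-(h : ℝ))..x, Poly.eval pw u * Poly.eval q u = Poly.eval (partIntegPoly pw q h) x := by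
  rw [eval_partIntegPoly]
  have h1 : ∫ u in (-(h : ℝ))..x, Poly.eval pw u * Poly.eval q u = ∫ u in (-(h : ℝ))..x, Poly.eval (Poly.mul pw q) u :=
    intervalIntegral.integral_congr fun u _ => by simp only [Poly.eval_mul]
  rw [h1, integral_eq_sub_of_hasDerivAt (fun u _ => hasDerivAt_eval_ad_zero (Poly.mul pw q) u)
    ((Poly.continuous_eval _).intervalIntegrable _ _)]

/-- Taylor model of `λ ↦ ∫_{-h}^{λ} f(u) q(u) du` from a Taylor model `W` of `f` (reference polynomial `pw`). [folklore] -/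
def partPanelTM (S : ℕ) (h : ℚ) (W : IPoly) (pw q : Poly) : IPoly :=
  widen0 (ratPolyI S (partIntegPoly pw q h)) ⌈(tabsI S h (tsubI W (ratPolyI S pw)) : ℚ) * (2 * h * absBoundQ q h)⌉

/-- **Partial panel.**  `TMem S h f W`, `f` interval integrable on `[-h, h]` ⇒
`TMem S h (λ ↦ ∫_{-h}^{λ} f(u) q(u) du) (partPanelTM S h W pw q)`. [folklore] -/
theorem tmem_partPanelTM {S : ℕ} (hS : 0 < S) {h : ℚ} (h0 : 0 ≤ h) {f : ℝ → ℝ} {W : IPoly}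
    (hf : TMem S h f W) (hfi : IntervalIntegrable f volume (-(h : ℝ)) h) (pw q : Poly) :
    TMem S h (fun x => ∫ u in (-(h : ℝ))..x, f u * Poly.eval q u) (partPanelTM S h W pw q) := by
  intro x hx
  set B : ℤ := tabsI S h (tsubI W (ratPolyI S pw)) with hB
  have hSr : (0 : ℝ) < S := by exact_mod_cast hS
  have hhr : (0 : ℝ) ≤ h := by exact_mod_cast h0
  have hxI : x ∈ Icc (-(h : ℝ)) h := ⟨by linarith [(abs_le.1 hx).1], (abs_le.1 hx).2⟩
  have hfx : IntervalIntegrable f volume (-(h : ℝ)) x :=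
    hfi.mono_set (by rw [uIcc_of_le (by linarith [hxI.1] : (-(h : ℝ)) ≤ x),
      uIcc_of_le (by linarith : (-(h : ℝ)) ≤ h)]; exact Icc_subset_Icc le_rfl hxI.2)
  have hfq : IntervalIntegrable (fun u => f u * Poly.eval q u) volume (-(h : ℝ)) x :=
    hfx.mul_continuousOn (Poly.continuous_eval q).continuousOn
  have hpq : IntervalIntegrable (fun u => Poly.eval pw u * Poly.eval q u) volume (-(h : ℝ)) x :=
    ((Poly.continuous_eval pw).mul (Poly.continuous_eval q)).intervalIntegrable _ _
  set δ : ℝ := (∫ u in (-(h : ℝ))..x, f u * Poly.eval q u) -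
    ∫ u in (-(h : ℝ))..x, Poly.eval pw u * Poly.eval q u with hδ
  have hδ' : δ = ∫ u in (-(h : ℝ))..x, (f u * Poly.eval q u - Poly.eval pw u * Poly.eval q u) := by
    rw [hδ, intervalIntegral.integral_sub hfq hpq]
  have hpt : ∀ u ∈ Ι (-(h : ℝ)) x, ‖f u * Poly.eval q u - Poly.eval pw u * Poly.eval q u‖ ≤
      (B : ℝ) / S * absBoundQ q h := by
    intro u hu
    rw [uIoc_of_le (by linarith [hxI.1] : (-(h : ℝ)) ≤ x)] at hu
    have hua : |u| ≤ h := abs_le.2 ⟨hu.1.le, hu.2.trans hxI.2⟩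
    rw [Real.norm_eq_abs, ← sub_mul, abs_mul]
    have h1 : |f u - Poly.eval pw u| ≤ (B : ℝ) / S := abs_sub_poly_le_of_tmem hS h0 hf pw hua
    exact mul_le_mul h1 (abs_eval_le_absBoundQ q hua) (abs_nonneg _) ((abs_nonneg _).trans h1)
  have hB0 : 0 ≤ (B : ℝ) / S :=
    (abs_nonneg _).trans (abs_sub_poly_le_of_tmem hS h0 hf pw (by rw [abs_zero]; exact hhr : |(0 : ℝ)| ≤ h))
  have hQ0 : 0 ≤ (absBoundQ q h : ℝ) :=
    (abs_nonneg _).trans (abs_eval_le_absBoundQ q (by rw [abs_zero]; exact hhr : |(0 : ℝ)| ≤ h))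
  have hδb : |δ| ≤ (B : ℝ) / S * absBoundQ q h * (2 * h) := by
    rw [hδ']
    refine (norm_integral_le_of_norm_le_const hpt).trans ?_
    have hlen : |x - -(h : ℝ)| ≤ 2 * h := by
      rw [abs_le]; constructor <;> linarith [hxI.1, hxI.2]
    exact mul_le_mul_of_nonneg_left hlen (mul_nonneg hB0 hQ0)
  have hδS : |δ| * S ≤ (⌈(B : ℚ) * (2 * h * absBoundQ q h)⌉ : ℤ) := by
    have hc : ((B : ℚ) * (2 * h * absBoundQ q h) : ℝ) ≤ (⌈(B : ℚ) * (2 * h * absBoundQ q h)⌉ : ℤ) := by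
      exact_mod_cast Int.le_ceil _
    have hδb' : |δ| ≤ (B : ℝ) * absBoundQ q h * (2 * h) / S := by
      rwa [div_mul_eq_mul_div, div_mul_eq_mul_div] at hδb
    have h2 := (le_div_iff₀ hSr).1 hδb'
    have e : (B : ℝ) * absBoundQ q h * (2 * h) = B * (2 * h * absBoundQ q h) := by ring
    push_cast at hc ⊢
    linarith
  obtain ⟨bs, hbs, hev⟩ := exists_widen0 (pmem_ratPoly S (partIntegPoly pw q h)) hδS x
  refine ⟨bs, hbs, ?_⟩
  rw [hev, ← Poly.eval_eq_evalR, ← integral_poly_mul_poly_eq, hδ]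
  ring

/-! ### The moving endpoint -/

/-- Taylor model of `ρ ↦ ∫_0^{t_j + ε ρ} w(t) q(t) dt` (`ε = −1` if `neg`, else `+1`): full panels `0, …, j−1` from `D`
(must have length `j`), the partial panel `j` from `(Wj, pwj)`. [folklore] -/
def movingIntegTM (S : ℕ) (h : ℚ) (D : List (IPoly × Poly)) (Wj : IPoly) (pwj : Poly) (q : Poly) (neg : Bool) :
    IPoly :=
  let part := partPanelTM S h Wj pwj (recenter q h D.length)
  taddI (tconst (fullPanelsI S h q D 0)) (if neg then treflI part else part)

/-- **The moving-endpoint integral.**  With `j = D.length`: if `D` encloses `w` on panels `0, …, j−1`, `Wj` encloses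
`u ↦ w(t_j + u)`, and `w` is interval integrable on the subintervals of `[0, ∞)`, then `movingIntegTM` encloses
`ρ ↦ ∫_0^{t_j + ερ} w(t) q(t) dt` on `|ρ| ≤ h`. [folklore] -/
theorem tmem_movingIntegTM {S : ℕ} (hS : 0 < S) {h : ℚ} (h0 : 0 ≤ h) {w : ℝ → ℝ}
    (hwi : ∀ a b : ℝ, 0 ≤ a → a ≤ b → IntervalIntegrable w volume a b) (D : List (IPoly × Poly))
    (hD : ∀ i : Fin D.length, TMem S h (fun u => w ((panelCentre h i : ℝ) + u)) (D.get i).1)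
    {Wj : IPoly} (hWj : TMem S h (fun u => w ((panelCentre h D.length : ℝ) + u)) Wj) (pwj q : Poly) (neg : Bool) :
    TMem S h (fun ρ => ∫ t in (0 : ℝ)..((panelCentre h D.length : ℝ) + (if neg then -ρ else ρ)), w t * Poly.eval q t)
      (movingIntegTM S h D Wj pwj q neg) := by
  have hhr : (0 : ℝ) ≤ h := by exact_mod_cast h0
  set j := D.length with hj
  have hj0 : (0 : ℝ) ≤ j := by exact_mod_cast Nat.zero_le j
  -- full panels
  have hfull : MI.mem S (∫ t in (0 : ℝ)..(2 * j * h : ℝ), w t * Poly.eval q t) (fullPanelsI S h q D 0) := by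
    have := mem_fullPanelsI hS h0 hwi q D 0 (by simpa using hD)
    simpa using this
  -- the partial panel as a function of the endpoint `λ`
  have hfi : IntervalIntegrable (fun u => w ((panelCentre h j : ℝ) + u)) volume (-(h : ℝ)) h := by
    have := (hwi (2 * j * h) (2 * (j + 1) * h) (by positivity) (by nlinarith)).comp_add_right
      ((panelCentre h j : ℝ))
    simp only [panelCentre, Rat.cast_mul, Rat.cast_add, Rat.cast_ofNat, Rat.cast_natCast, Rat.cast_one] at this ⊢
    convert this using 1 <;> ring
  have hpart := tmem_partPanelTM hS h0 hWj hfi pwj (recenter q h j)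
  -- `∫_0^{t_j+λ} = ∫_0^{2jh} + ∫_{-h}^{λ} (shifted)` for `|λ| ≤ h`
  have hsplit : ∀ lam : ℝ, |lam| ≤ h →
      ∫ t in (0 : ℝ)..((panelCentre h j : ℝ) + lam), w t * Poly.eval q t =
        (∫ t in (0 : ℝ)..(2 * j * h : ℝ), w t * Poly.eval q t) +
          ∫ u in (-(h : ℝ))..lam, w ((panelCentre h j : ℝ) + u) * Poly.eval (recenter q h j) u := by
    intro lam hlam
    have hl := abs_le.1 hlam
    have hc : ((panelCentre h j : ℚ) : ℝ) = (2 * j + 1) * h := by simp [panelCentre]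
    have hI1 : IntervalIntegrable (fun t => w t * Poly.eval q t) volume 0 (2 * j * h : ℝ) :=
      (hwi _ _ le_rfl (by positivity)).mul_continuousOn (Poly.continuous_eval q).continuousOn
    have hI2 : IntervalIntegrable (fun t => w t * Poly.eval q t) volume (2 * j * h : ℝ)
        ((panelCentre h j : ℝ) + lam) :=
      (hwi _ _ (by positivity) (by rw [hc]; nlinarith)).mul_continuousOn (Poly.continuous_eval q).continuousOn
    rw [← integral_add_adjacent_intervals hI1 hI2]
    congr 1
    simp_rw [eval_recenter]
    rw [intervalIntegral.integral_comp_add_left (fun t => w t * Poly.eval q t) ((panelCentre h j : ℝ)), hc]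
    congr 1
    ring
  have hcst := tmem_const (h := h) hfull (S := S)
  cases neg with
  | false =>
      simp only [Bool.false_eq_true, ↓reduceIte]
      intro ρ hρ
      obtain ⟨as, has, e⟩ := tmem_add hcst hpart ρ hρ
      refine ⟨as, has, ?_⟩
      beta_reduce
      rw [hsplit ρ hρ]
      exact e
  | true =>
      simp only [↓reduceIte]
      intro ρ hρ
      obtain ⟨as, has, e⟩ := tmem_add hcst (tmem_refl hpart) ρ hρ
      refine ⟨as, has, ?_⟩
      beta_reduce
      rw [hsplit (-ρ) (by rwa [abs_neg])]
      exact e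

/-! ### Bivariate integrands `Q(ρ, t) = Σ_a Q_a(t) ρ^a` -/

/-- `t ↦ BPoly.eval Q t x` is continuous. [folklore] -/
theorem continuous_beval_fst (x : ℝ) : ∀ Q : BPoly, Continuous fun t => BPoly.eval Q t x
  | [] => by simpa using continuous_const
  | c :: Q => by
      simp only [BPoly.eval_cons]
      exact (Poly.continuous_eval c).add (continuous_const.mul (continuous_beval_fst x Q))

/-- Taylor model of `ρ ↦ ∫_0^{t_j + ερ} w(t) Q(ρ, t) dt` for `Q : BPoly` (entry `a` = the polynomial `Q_a(t)` multiplying `ρ^a`),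
truncated to degree `Dg` after each step. [folklore] -/
def movingIntegBTM (S : ℕ) (h : ℚ) (Dg : ℕ) (D : List (IPoly × Poly)) (Wj : IPoly) (pwj : Poly) (neg : Bool) :
    BPoly → IPoly
  | [] => []
  | qa :: Q => ttruncI S h Dg (taddI (movingIntegTM S h D Wj pwj qa neg) (tmulXI (movingIntegBTM S h Dg D Wj pwj neg Q)))

/-- **The moving-endpoint integral of a bivariate polynomial integrand.**  Under the hypotheses of `tmem_movingIntegTM`,
`movingIntegBTM` encloses `ρ ↦ ∫_0^{t_j + ερ} w(t) · BPoly.eval Q t ρ dt` on `|ρ| ≤ h`. [folklore] -/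
theorem tmem_movingIntegBTM {S : ℕ} (hS : 0 < S) {h : ℚ} (h0 : 0 ≤ h) (Dg : ℕ) {w : ℝ → ℝ}
    (hwi : ∀ a b : ℝ, 0 ≤ a → a ≤ b → IntervalIntegrable w volume a b) (D : List (IPoly × Poly))
    (hD : ∀ i : Fin D.length, TMem S h (fun u => w ((panelCentre h i : ℝ) + u)) (D.get i).1)
    {Wj : IPoly} (hWj : TMem S h (fun u => w ((panelCentre h D.length : ℝ) + u)) Wj) (pwj : Poly) (neg : Bool) :
    ∀ Q : BPoly, TMem S h
      (fun ρ => ∫ t in (0 : ℝ)..((panelCentre h D.length : ℝ) + (if neg then -ρ else ρ)), w t * BPoly.eval Q t ρ)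
      (movingIntegBTM S h Dg D Wj pwj neg Q)
  | [] => fun ρ _ => ⟨[], pmem_nil S, by simp⟩
  | qa :: Q => by
      have ih := tmem_movingIntegBTM hS h0 Dg hwi D hD hWj pwj neg Q
      have h1 := tmem_movingIntegTM hS h0 hwi D hD hWj pwj qa neg
      have hsum := tmem_trunc h0 Dg (tmem_add h1 (tmem_mulX hS ih))
      rw [movingIntegBTM]
      refine fun ρ hρ => ?_
      obtain ⟨as, has, e⟩ := hsum ρ hρ
      refine ⟨as, has, ?_⟩
      rw [← e]
      -- linearity of the integral: `∫ w (qa + ρ Q) = ∫ w qa + ρ ∫ w Q`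
      set T : ℝ := (panelCentre h D.length : ℝ) + (if neg then -ρ else ρ) with hT
      have hT0 : 0 ≤ T := by
        have hl := abs_le.1 hρ
        have : ((panelCentre h D.length : ℚ) : ℝ) = (2 * D.length + 1) * h := by simp [panelCentre]
        rw [hT, this]
        have hj0 : (0 : ℝ) ≤ D.length := by exact_mod_cast Nat.zero_le _
        have hhr : (0 : ℝ) ≤ h := by exact_mod_cast h0
        cases neg <;> simp <;> nlinarith
      have hIa : IntervalIntegrable (fun t => w t * Poly.eval qa t) volume 0 T :=
        (hwi _ _ le_rfl hT0).mul_continuousOn (Poly.continuous_eval qa).continuousOn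
      have hIQ : IntervalIntegrable (fun t => w t * BPoly.eval Q t ρ) volume 0 T :=
        (hwi _ _ le_rfl hT0).mul_continuousOn (continuous_beval_fst ρ Q).continuousOn
      simp only [BPoly.eval_cons]
      have e2 : ∀ t, w t * (Poly.eval qa t + ρ * BPoly.eval Q t ρ) =
          w t * Poly.eval qa t + ρ * (w t * BPoly.eval Q t ρ) := fun t => by ring
      simp_rw [e2]
      rw [intervalIntegral.integral_add hIa (hIQ.const_mul ρ), intervalIntegral.integral_const_mul]

end PolyMP

end Literature.Analysis.ValidatedNumerics
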